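import Literature.NumberTheory.EllipticCurves.IwasawaAlgebraPseudoNullProofs
import Literature.NumberTheory.EllipticCurves.IwasawaAlgebraProofs
import Literature.NumberTheory.EllipticCurves.IwasawaAlgebraCharIdealProofs
import Mathlib.RingTheory.Ideal.Height
import HarnessLib

/-!
# Road (b″) netted, the archimedean factor at `2`, algebra half: a finitely generated `Λ`-module KILLED BY `p`
# is finite iff its local length at the height-one prime `(p)` vanishes; if it is infinite, `ℓ_{(p)} ≥ 1`

Cell `bsd-f1-sign2`, WIDTH-5 attach seat `bsd-line-att-p4` (gen 4) on line `birth` of crux C2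
stmt-BirchSwinnertonDyer-22298 `MainConjectureOfRankZeroBSDAtTwo`; a `--supports 22298 --as helper` file (pure commutative
algebra over `Λ = IwasawaAlgebra p = ℤ_p⟦T⟧`). HONEST FRAMING: THEOREMS ONLY — no definition, no named fact, no `sorry`;
BSD is NOT proved by any of this.

WHY. In the displayed `KatoNetDataRelAtTwo` (K₂ⁿᵉᵗʳ) of skeleton v7/v8 the archimedean bookkeeping of Greenberg, LNM 1716
Lemma 4.6 (+ Remark p. 106) enters as `e ≤ ℓ₍₂₎(ker q)` for the archimedean extension `q : X^{rel ∞} ↠ X(W/ℚ_∞)` — its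
kernel is the Pontryagin dual of `Sel^{rel ∞}(ℚ_∞)/Sel(ℚ_∞)`, a group KILLED BY `2` (att-p4 g3
`LocalArch.two_nsmul_mem_selmerGroupOver_of_mem_relaxed`) and, for `Δ_W > 0` and `X` cotorsion, INFINITE (the typed fact
`Greenberg1999.lemma46_relaxed_mod_selmer_infinite_rat_two`, -ty g7 p608868). The passage «infinite `Λ`-module killed by `2`
⟹ `ℓ₍₂₎ ≥ 1`» needs finite generation and is exactly this file (for every `p`):

* `lengthAt_eq_zero_of_C_smul_eq_zero_of_notMem` — if `p · N = 0` then `ℓ_𝔮(N) = 0` at every prime `𝔮 ∌ p`.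
* `eq_augIdealP_of_mem_of_height_le_one` — a prime `𝔮 ∋ p` of height `≤ 1` IS `(p)` (tree `height_augIdealP_holds`,
  Mathlib `Ideal.eq_of_le_of_height_le`).
* **`finite_of_C_smul_eq_zero_of_lengthAt_eq_zero`** — `N` f.g., `p · N = 0`, `ℓ_{(p)}(N) = 0` ⟹ `N` pseudo-null ⟹ FINITE
  (tree `IwasawaAlgebra.finite_of_isPseudoNull`); converse `lengthAt_augIdealP_eq_zero_of_finite`;
  `finite_iff_lengthAt_augIdealP_eq_zero`.
* **`one_le_lengthAt_augIdealP_of_infinite`** — `N` f.g., `p · N = 0`, `N` infinite ⟹ `1 ≤ ℓ_{(p)}(N)`; at `p = 2` with the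
  hypothesis spelled `2 • n = 0`: **`one_le_lengthAt_two_of_infinite`** — the «hard half» `1 = [Δ_W > 0] ≤ ℓ₍₂₎(ker q)` of the
  archimedean bookkeeping follows for ANY finitely generated dual receptacle of `Sel^{rel ∞}/Sel` (att-p3 g3's
  `lengthAt_le_of_coinvDatum_netting` consumes exactly this inequality).

References: R. Greenberg, LNM 1716 (1999), §4 Lemma 4.6 and Remark (PDF pp. 105–107); J. Neukirch, A. Schmidt, K. Wingberg,
*Cohomology of Number Fields* (2008), (5.1.4) Remark 4 (pseudo-null = finite over `ℤ_p⟦T⟧`); L. Washington, *Cyclotomic Fields* §13.2.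
-/

set_option autoImplicit false
-- the Theorems namespace of this sub repeats the summit name by design (D-0017 nested layout)
set_option linter.dupNamespace false

noncomputable section

namespace Summit.BirchSwinnertonDyer.BirchSwinnertonDyer.Theorems.AlignedTransportAtTwoFineRoad.LambdaModP

open Literature.NumberTheory.EllipticCurves Literature.NumberTheory.EllipticCurves.IwasawaAlgebra
  Literature.NumberTheory.EllipticCurves.Module

variable (p : ℕ) [Fact p.Prime] {N : Type*} [AddCommGroup N] [_root_.Module (IwasawaAlgebra p) N]

/-- **Away from `(p)` a module killed by `p` has local length `0`**: if `p · N = 0` and `p ∉ 𝔮` then `N_𝔮 = 0` (`p` is a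
unit of `Λ_𝔮`). [cite: Washington1997, §13.2] -/
theorem lengthAt_eq_zero_of_C_smul_eq_zero_of_notMem
    (hp : ∀ n : N, (PowerSeries.C (p : ℤ_[p]) : IwasawaAlgebra p) • n = 0)
    (𝔮 : PrimeSpectrum (IwasawaAlgebra p)) (h𝔮 : (PowerSeries.C (p : ℤ_[p]) : IwasawaAlgebra p) ∉ 𝔮.asIdeal) :
    lengthAt (IwasawaAlgebra p) N 𝔮 = 0 := by
  rw [lengthAt_eq_zero_iff, LocalizedModule.subsingleton_iff]
  exact fun m ↦ ⟨_, h𝔮, hp m⟩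

/-- **A prime `𝔮 ∋ p` of `Λ = ℤ_p⟦T⟧` of height `≤ 1` is the prime `(p)`**: `(p) ≤ 𝔮`, `(p)` is prime of height `1`
(tree `isPrime_augIdealP_holds`, `height_augIdealP_holds`), and a prime of finite height equals any ideal above it of no
greater height (Mathlib `Ideal.eq_of_le_of_height_le`). [cite: Washington1997, §13.2] -/
theorem eq_augIdealP_of_mem_of_height_le_one (𝔮 : PrimeSpectrum (IwasawaAlgebra p))
    (hmem : (PowerSeries.C (p : ℤ_[p]) : IwasawaAlgebra p) ∈ 𝔮.asIdeal) (hht : 𝔮.asIdeal.height ≤ 1) :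
    𝔮.asIdeal = augIdealP p := by
  haveI : (augIdealP p).IsPrime := isPrime_augIdealP_holds p
  have hle : augIdealP p ≤ 𝔮.asIdeal := by
    rw [augIdealP, Ideal.span_le, Set.singleton_subset_iff]
    exact hmem
  refine (Ideal.eq_of_le_of_height_le (augIdealP p) hle ?_).symm
  rw [show (augIdealP p).height = 1 from height_augIdealP_holds p]
  exact hht

/-- **A finitely generated `Λ`-module killed by `p` with `ℓ_{(p)} = 0` is FINITE**: its local lengths vanish at every
prime of height `≤ 1` (away from `(p)` by `lengthAt_eq_zero_of_C_smul_eq_zero_of_notMem`, at `(p)` by hypothesis), i.e.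
it is pseudo-null, hence finite (tree `IwasawaAlgebra.finite_of_isPseudoNull`).
[cite: NeukirchSchmidtWingberg2008, Ch. V §1, (5.1.4) Remark 4] [cite: Washington1997, §13.2] -/
theorem finite_of_C_smul_eq_zero_of_lengthAt_eq_zero [Module.Finite (IwasawaAlgebra p) N]
    (hp : ∀ n : N, (PowerSeries.C (p : ℤ_[p]) : IwasawaAlgebra p) • n = 0)
    (h0 : lengthAt (IwasawaAlgebra p) N ⟨augIdealP p, isPrime_augIdealP_holds p⟩ = 0) : Finite N := by
  refine finite_of_isPseudoNull p N fun 𝔮 h𝔮 ↦ ?_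
  by_cases hmem : (PowerSeries.C (p : ℤ_[p]) : IwasawaAlgebra p) ∈ 𝔮.asIdeal
  · have heq : 𝔮 = ⟨augIdealP p, isPrime_augIdealP_holds p⟩ :=
      PrimeSpectrum.ext (eq_augIdealP_of_mem_of_height_le_one p 𝔮 hmem h𝔮)
    rw [heq]
    exact (lengthAt_eq_zero_iff (M := N) _).mp h0
  · exact (lengthAt_eq_zero_iff (M := N) 𝔮).mp (lengthAt_eq_zero_of_C_smul_eq_zero_of_notMem p hp 𝔮 hmem)

/-- Conversely a FINITE `Λ`-module has `ℓ_{(p)} = 0` (finite = pseudo-null, tree `isPseudoNull_of_finite`; `(p)` has height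
`1`). [cite: NeukirchSchmidtWingberg2008, Ch. V §1, (5.1.4) Remark 4] -/
theorem lengthAt_augIdealP_eq_zero_of_finite [Finite N] :
    lengthAt (IwasawaAlgebra p) N ⟨augIdealP p, isPrime_augIdealP_holds p⟩ = 0 := by
  rw [lengthAt_eq_zero_iff]
  exact isPseudoNull_of_finite p N _ (le_of_eq (height_augIdealP_holds p))

/-- **For a finitely generated `Λ`-module killed by `p`: finite ⟺ `ℓ_{(p)} = 0`** (the `μ`-part of an `𝔽_p⟦T⟧`-module is
all there is away from finitely many points). [cite: Washington1997, §13.2] -/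
theorem finite_iff_lengthAt_augIdealP_eq_zero [Module.Finite (IwasawaAlgebra p) N]
    (hp : ∀ n : N, (PowerSeries.C (p : ℤ_[p]) : IwasawaAlgebra p) • n = 0) :
    Finite N ↔ lengthAt (IwasawaAlgebra p) N ⟨augIdealP p, isPrime_augIdealP_holds p⟩ = 0 :=
  ⟨fun _ ↦ lengthAt_augIdealP_eq_zero_of_finite p, finite_of_C_smul_eq_zero_of_lengthAt_eq_zero p hp⟩

/-- **An INFINITE finitely generated `Λ`-module killed by `p` has `ℓ_{(p)} ≥ 1`** (it contains the `μ`-part `Λ/p` at least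
once). This is the algebra half of Greenberg's archimedean count at `p = 2`: `ker(X^{rel ∞} ↠ X)` is the dual of
`Sel^{rel ∞}/Sel`, killed by `2` and infinite when `E[2] ⊂ E(ℝ)`, so `1 ≤ ℓ₍₂₎(ker q)`.
[cite: GreenbergLNM1716, §4 Lemma 4.6 and Remark (PDF pp. 105–107)] [cite: Washington1997, §13.2] -/
theorem one_le_lengthAt_augIdealP_of_infinite [Module.Finite (IwasawaAlgebra p) N] [Infinite N]
    (hp : ∀ n : N, (PowerSeries.C (p : ℤ_[p]) : IwasawaAlgebra p) • n = 0) :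
    1 ≤ lengthAt (IwasawaAlgebra p) N ⟨augIdealP p, isPrime_augIdealP_holds p⟩ := by
  rw [Order.one_le_iff_ne_zero]
  intro h0
  haveI := finite_of_C_smul_eq_zero_of_lengthAt_eq_zero p hp h0
  exact not_finite N

/-- **`p = 2`, hypothesis spelled `2 • n = 0`**: an infinite finitely generated `Λ = ℤ₂⟦T⟧`-module killed by `2` has
`ℓ₍₂₎ ≥ 1`. With att-p3 g3's netting lemma this is the input `e ≤ ℓ₍₂₎(ker q)`, `e = 1`, for ANY finitely generated
receptacle of the dual of `Sel^{rel ∞}(ℚ_∞)/Sel(ℚ_∞)` once that quotient is infinite (typed fact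
`Greenberg1999.lemma46_relaxed_mod_selmer_infinite_rat_two` for `Δ_W > 0`). [cite: GreenbergLNM1716, §4 Lemma 4.6 and Remark (PDF pp. 105–107)] -/
theorem one_le_lengthAt_two_of_infinite {N : Type*} [AddCommGroup N] [_root_.Module (IwasawaAlgebra 2) N]
    [Module.Finite (IwasawaAlgebra 2) N] [Infinite N] (h2 : ∀ n : N, (2 : ℕ) • n = 0) :
    1 ≤ lengthAt (IwasawaAlgebra 2) N ⟨augIdealP 2, isPrime_augIdealP_holds 2⟩ := by
  refine one_le_lengthAt_augIdealP_of_infinite 2 fun n ↦ ?_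
  rw [show (PowerSeries.C ((2 : ℕ) : ℤ_[2]) : IwasawaAlgebra 2) = ((2 : ℕ) : IwasawaAlgebra 2) by
    rw [map_natCast], Nat.cast_smul_eq_nsmul]
  exact h2 n

/-- Companion: a FINITE quotient killed by `2` contributes nothing at `(2)` — for a finitely generated `ℤ₂⟦T⟧`-module
killed by `2`, `ℓ₍₂₎ = 0 ⟺ finite` (so for `Δ_W < 0`, where `Sel^{rel ∞} = Sel` by `LocalArch.relaxed_eq_selmerGroupOver_of_Δ_neg`,
`ℓ₍₂₎(ker q) = 0`). [cite: GreenbergLNM1716, §4 (PDF pp. 106–107)] -/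
theorem lengthAt_two_eq_zero_iff_finite {N : Type*} [AddCommGroup N] [_root_.Module (IwasawaAlgebra 2) N]
    [Module.Finite (IwasawaAlgebra 2) N] (h2 : ∀ n : N, (2 : ℕ) • n = 0) :
    lengthAt (IwasawaAlgebra 2) N ⟨augIdealP 2, isPrime_augIdealP_holds 2⟩ = 0 ↔ Finite N := by
  refine (finite_iff_lengthAt_augIdealP_eq_zero 2 fun n ↦ ?_).symm
  rw [show (PowerSeries.C ((2 : ℕ) : ℤ_[2]) : IwasawaAlgebra 2) = ((2 : ℕ) : IwasawaAlgebra 2) by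
    rw [map_natCast], Nat.cast_smul_eq_nsmul]
  exact h2 n

end Summit.BirchSwinnertonDyer.BirchSwinnertonDyer.Theorems.AlignedTransportAtTwoFineRoad.LambdaModP

end
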